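import Literature.AnabelianGeometry.EtaleTheta.Discharge.Sec1DeltaThetaEndoComm
import HarnessLib

/-!
# [EtTh] Prop. 1.5 (i) «F¹/F² = Ẑ·log(U)»: the identification FOLLOWS from «log(U) restricts to the standard isomorphism»
# (the `Y`-side twin of `Sec1Prop15iiQuotOfStdLog` / `Sec1DeltaThetaEndoComm`; proof-only)

Mochizuki, *The étale theta function and its Frobenioid-theoretic manifestations*, Publ. RIMS **45** (2009), Prop. 1.5 (i)
p. 23 (printed 249): «F¹/F² = Hom((Δ^tp_Y)^ell/Δ_Θ, Δ_Θ) = Ẑ·log(U) … — where … the symbol log(U) [denotes] the standard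
isomorphism (Δ^tp_Y)^ell/Δ_Θ ⥲ Ẑ(1) ⥲ Δ_Θ»; «Assertions (i), (ii) follow immediately from the definitions»
[cite: MochizukiEtTh2009, Prop 1.5 (i) p.23]. abc-iut cell, layer L2, seat abc-iut-L2-t1 (§1 ROOT owner). PROOF-ONLY
(0 `def`): for the root predicate `ThetaSetting.Prop15iQuot E hC := ∃ λ, IsStdLog λ ∧ F1QuotSpec E hC λ`
(`ThetaCohomologyZHatLog.lean`), clauses (b) «F¹/F² ⊆ End(Δ_Θ)·[λ]» and (c) «⊇» are THEOREMS of clause (a)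
«res_{(Δ^tp_Y)^Θ} log(U) = [λ]» given the census topology predicate `HasThetaTopology` (here the compactness of `(Δ^tp_Y)^Θ`
is a FIELD of it) and the guard `IsEtThOrigin` (`Ẑ`-linearity: `IsEtThOrigin.endo_conjNormal_comm`).
* `ThetaSetting.logU_mem_F1_of_stdLog`, `exists_endo_of_mem_F1`, `exists_mem_F1_of_endo`, `prop15iQuot_of_stdLog`,
  `prop15iQuot_of_stdLog_of_hasThetaTopology`.
HONEST FRAMING: [EtTh] is refereed; nothing here bears on [IUTchIII] Cor. 3.12; typed ≠ proved; no side taken.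
-/

noncomputable section

namespace Literature.AnabelianGeometry.EtaleTheta

open Literature.AnabelianGeometry.SemiGraphs _root_.Topology
open scoped IsMulCommutative

namespace ThetaSetting

variable {p : ℕ} [Fact p.Prime] {D : ThetaSetting p}

/-- **(a) ⇒ «log(U) ∈ F¹»** (the `Y`-side twin of `logUdd_mem_Fdd1_of_stdLog`). [cite: MochizukiEtTh2009, Prop 1.5 (i) p.23] -/
theorem logU_mem_F1_of_stdLog (hC : D.Compat) {E : D.KummerData} {lam : D.DtpYTheta →ₜ* D.DeltaTheta}
    (hstd : IsStdLog lam)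
    (hres : ContH1.res (MonoidHom.id D.GtpTheta) D.DeltaTheta
      (Subgroup.map_mono inf_le_left : D.DtpYTheta ≤ D.GtpY.map D.toTheta) E.logU =
      homClass dtpYTheta_le_deltaTheta_map lam) :
    E.logU ∈ F1 hC := by
  have h23 : D.DtpYTheta ≤ D.GtpY.map D.toTheta := Subgroup.map_mono inf_le_left
  have h12 : D.DeltaTheta ≤ D.DtpYTheta := hC.deltaTheta_le_DtpYTheta
  have key := ContH1.res_res (φ := MonoidHom.id D.GtpTheta) (A := D.DeltaTheta) h12 h23 E.logU
  have hres' : ContH1.res (MonoidHom.id D.GtpTheta) D.DeltaTheta h23 E.logU =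
      homClass dtpYTheta_le_deltaTheta_map lam := hres
  have h1 : homClass (h12.trans dtpYTheta_le_deltaTheta_map) (lam.comp (inclCMH h12)) = 1 :=
    (homClass_eq_one_iff _ _).mpr fun t => (hstd.ker_iff _).mpr t.2
  rw [hres', res_homClass, h1] at key
  exact key.symm

/-- **Clause (b) of `F1QuotSpec` is automatic** (twin of `exists_endo_of_mem_Fdd1`): every `d ∈ F¹` restricts on
`(Δ^tp_Y)^Θ` to `e ∘ λ` for a continuous endomorphism `e` of `Δ_Θ`, whenever `(Δ^tp_Y)^Θ` is compact and `(Π^tp_X)^Θ`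
Hausdorff. [cite: MochizukiEtTh2009, Prop 1.5 (i) p.23] -/
theorem exists_endo_of_mem_F1 (hC : D.Compat) [T2Space D.GtpTheta]
    (hcpt : IsCompact (((D.DtpYTheta : Subgroup D.GtpTheta)) : Set D.GtpTheta))
    {lam : D.DtpYTheta →ₜ* D.DeltaTheta} (hstd : IsStdLog lam)
    {d : D.H1Theta (D.GtpY.map D.toTheta)} (hd : d ∈ F1 hC) :
    ∃ e : D.DeltaTheta →ₜ* D.DeltaTheta,
      ContH1.res (MonoidHom.id D.GtpTheta) D.DeltaTheta
        (Subgroup.map_mono inf_le_left : D.DtpYTheta ≤ D.GtpY.map D.toTheta) d =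
        homClass dtpYTheta_le_deltaTheta_map (e.comp lam) := by
  have h23 : D.DtpYTheta ≤ D.GtpY.map D.toTheta := Subgroup.map_mono inf_le_left
  obtain ⟨f, rfl⟩ := QuotientGroup.mk_surjective d
  set g : D.DtpYTheta → D.DeltaTheta := fun h => f.1 ⟨h.1, h23 h.2⟩ with hgdef
  have gcont : Continuous g := f.2.1.comp (continuous_subtype_val.subtype_mk _)
  have gmul : ∀ x y, g (x * y) = g x * g y := by
    intro x y
    have h := f.2.2 ⟨x.1, h23 x.2⟩ ⟨y.1, h23 y.2⟩
    rw [MonoidHom.id_apply, conjNormal_deltaTheta_eq_self (dtpYTheta_le_deltaTheta_map x.2)] at h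
    exact h
  have gone : g 1 = 1 := by
    have h := gmul 1 1
    rwa [mul_one, left_eq_mul] at h
  let gHom : D.DtpYTheta →* D.DeltaTheta := { toFun := g, map_one' := gone, map_mul' := gmul }
  have hΔ : D.DeltaTheta ≤ D.DtpYTheta := hC.deltaTheta_le_DtpYTheta
  have gker : ∀ h : D.DtpYTheta, (h : D.GtpTheta) ∈ D.DeltaTheta → g h = 1 := by
    intro h hh
    have hd' : ContH1.res (MonoidHom.id D.GtpTheta) D.DeltaTheta (hΔ.trans h23) (QuotientGroup.mk f) = 1 := hd
    change ContH1.mk _ (ContH1.resCocycle (MonoidHom.id D.GtpTheta) D.DeltaTheta (hΔ.trans h23) f).2 = 1 at hd'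
    rw [ContH1.mk_eq_one_iff, mem_contCoboundaries_iff] at hd'
    obtain ⟨a, ha⟩ := hd'
    have := congrFun ha ⟨h.1, hh⟩
    rw [MonoidHom.id_apply, conjNormal_deltaTheta_eq_self (dtpYTheta_le_deltaTheta_map (hΔ hh)),
      mul_inv_cancel] at this
    exact this
  have hle : lam.toMonoidHom.ker ≤ gHom.ker := by
    intro h hh
    rw [MonoidHom.mem_ker] at hh ⊢
    exact gker h ((hstd.ker_iff h).mp hh)
  let q := QuotientGroup.quotientKerEquivOfSurjective lam.toMonoidHom hstd.surjective
  let e₀ : D.DeltaTheta →* D.DeltaTheta := (QuotientGroup.lift lam.toMonoidHom.ker gHom hle).comp q.symm.toMonoidHom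
  have he₀ : ∀ h, e₀ (lam h) = g h := by
    intro h
    have hq : q.symm (lam h) = QuotientGroup.mk h := by
      apply q.injective
      rw [MulEquiv.apply_symm_apply]
      rfl
    change QuotientGroup.lift lam.toMonoidHom.ker gHom hle (q.symm (lam h)) = g h
    rw [hq]
    rfl
  haveI : CompactSpace D.DtpYTheta := isCompact_iff_compactSpace.mp hcpt
  have hqm : IsQuotientMap lam :=
    (map_continuous lam).isClosedMap.isQuotientMap (map_continuous lam) hstd.surjective
  have econt : Continuous e₀ := by
    rw [hqm.continuous_iff]
    have : (e₀ : D.DeltaTheta → D.DeltaTheta) ∘ lam = g := funext fun h => he₀ h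
    rw [this]
    exact gcont
  refine ⟨{ toMonoidHom := e₀, continuous_toFun := econt }, ?_⟩
  change ContH1.mk g (ContH1.resCocycle (MonoidHom.id D.GtpTheta) D.DeltaTheta h23 f).2 = ContH1.mk _ _
  exact ContH1.mk_congr _ (funext fun h => (he₀ h).symm) _ _

/-- **Clause (c) of `F1QuotSpec` from (a) + `Ẑ`-linearity** (twin of `exists_mem_Fdd1_of_endo`): the class
`e_* log(U) ∈ F¹` restricts on `(Δ^tp_Y)^Θ` to `e ∘ λ`. [cite: MochizukiEtTh2009, Prop 1.5 (i) p.23] -/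
theorem exists_mem_F1_of_endo (hC : D.Compat) {E : D.KummerData} {lam : D.DtpYTheta →ₜ* D.DeltaTheta}
    (hstd : IsStdLog lam)
    (hres : ContH1.res (MonoidHom.id D.GtpTheta) D.DeltaTheta
      (Subgroup.map_mono inf_le_left : D.DtpYTheta ≤ D.GtpY.map D.toTheta) E.logU =
      homClass dtpYTheta_le_deltaTheta_map lam)
    (hZ : ∀ (e : D.DeltaTheta →ₜ* D.DeltaTheta), ∀ g ∈ D.GtpY.map D.toTheta, ∀ a : D.DeltaTheta,
      e (MulAut.conjNormal g a) = MulAut.conjNormal g (e a))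
    (e : D.DeltaTheta →ₜ* D.DeltaTheta) :
    ∃ d ∈ F1 hC, ContH1.res (MonoidHom.id D.GtpTheta) D.DeltaTheta
        (Subgroup.map_mono inf_le_left : D.DtpYTheta ≤ D.GtpY.map D.toTheta) d =
      homClass dtpYTheta_le_deltaTheta_map (e.comp lam) := by
  have h23 : D.DtpYTheta ≤ D.GtpY.map D.toTheta := Subgroup.map_mono inf_le_left
  have hcomm : ∀ g : D.GtpTheta, g ∈ D.GtpY.map D.toTheta → ∀ a : D.DeltaTheta,
      e.toMonoidHom (MulAut.conjNormal ((MonoidHom.id D.GtpTheta) g) a) =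
        MulAut.conjNormal ((MonoidHom.id D.GtpTheta) g) (e.toMonoidHom a) :=
    fun g hg a => hZ e g hg a
  refine ⟨ContH1.mapEndo (MonoidHom.id D.GtpTheta) D.DeltaTheta (D.GtpY.map D.toTheta) e.toMonoidHom
    (map_continuous e) hcomm E.logU, ?_, ?_⟩
  · have hL : E.logU ∈ F1 hC := logU_mem_F1_of_stdLog hC hstd hres
    have key := ContH1.res_mapEndo (MonoidHom.id D.GtpTheta) D.DeltaTheta (D.GtpY.map D.toTheta)
      e.toMonoidHom (map_continuous e) hcomm (hle := hC.deltaTheta_le_DtpYTheta.trans h23) E.logU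
    have hL' : ContH1.res (MonoidHom.id D.GtpTheta) D.DeltaTheta (hC.deltaTheta_le_DtpYTheta.trans h23) E.logU = 1 :=
      hL
    rw [hL', map_one] at key
    exact key
  · have key := ContH1.res_mapEndo (MonoidHom.id D.GtpTheta) D.DeltaTheta (D.GtpY.map D.toTheta)
      e.toMonoidHom (map_continuous e) hcomm (hle := h23) E.logU
    have hres' : ContH1.res (MonoidHom.id D.GtpTheta) D.DeltaTheta h23 E.logU =
        homClass dtpYTheta_le_deltaTheta_map lam := hres
    rw [hres'] at key
    change ContH1.res (MonoidHom.id D.GtpTheta) D.DeltaTheta h23 _ = _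
    rw [key]
    change ContH1.mapEndo _ _ _ _ _ _ (ContH1.mk _ _) = ContH1.mk _ _
    rw [ContH1.mapEndo_mk]
    rfl

/-- **«F¹/F² = Ẑ·log(U)» from clause (a)** given `(Π^tp_X)^Θ` Hausdorff, `(Δ^tp_Y)^Θ` compact and `Ẑ`-linearity (twin of
`prop15iiQuot_of_stdLog`). [cite: MochizukiEtTh2009, Prop 1.5 (i) p.23] -/
theorem prop15iQuot_of_stdLog (hC : D.Compat) {E : D.KummerData} [T2Space D.GtpTheta]
    (hcpt : IsCompact (((D.DtpYTheta : Subgroup D.GtpTheta)) : Set D.GtpTheta))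
    (hZ : ∀ (e : D.DeltaTheta →ₜ* D.DeltaTheta), ∀ g ∈ D.GtpY.map D.toTheta, ∀ a : D.DeltaTheta,
      e (MulAut.conjNormal g a) = MulAut.conjNormal g (e a))
    {lam : D.DtpYTheta →ₜ* D.DeltaTheta} (hstd : IsStdLog lam)
    (hres : ContH1.res (MonoidHom.id D.GtpTheta) D.DeltaTheta
      (Subgroup.map_mono inf_le_left : D.DtpYTheta ≤ D.GtpY.map D.toTheta) E.logU =
      homClass dtpYTheta_le_deltaTheta_map lam) :
    Prop15iQuot E hC :=
  ⟨lam, hstd, ⟨hres, fun _ hd => exists_endo_of_mem_F1 hC hcpt hstd hd,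
    fun e => exists_mem_F1_of_endo hC hstd hres hZ e⟩⟩

/-- **«F¹/F² = Ẑ·log(U)» from clause (a) ALONE at an origin setting with the census topology predicate** (twin of
`prop15iiQuot_of_stdLog_of_hasThetaTopology`; `(Δ^tp_Y)^Θ` compact is a field of `HasThetaTopology`).
[cite: MochizukiEtTh2009, Prop 1.5 (i) p.23] -/
theorem prop15iQuot_of_stdLog_of_hasThetaTopology (hC : D.Compat) (hT : D.HasThetaTopology) (hO : D.IsEtThOrigin)
    {E : D.KummerData} {lam : D.DtpYTheta →ₜ* D.DeltaTheta} (hstd : IsStdLog lam)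
    (hres : ContH1.res (MonoidHom.id D.GtpTheta) D.DeltaTheta
      (Subgroup.map_mono inf_le_left : D.DtpYTheta ≤ D.GtpY.map D.toTheta) E.logU =
      homClass dtpYTheta_le_deltaTheta_map lam) :
    Prop15iQuot E hC := by
  haveI := hT.t2Space_gtpTheta
  exact prop15iQuot_of_stdLog hC hT.isCompact_dtpYTheta (fun e g _ a => hO.endo_conjNormal_comm hT.hYcl e g a)
    hstd hres

end ThetaSetting

end Literature.AnabelianGeometry.EtaleTheta

end
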